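/-
Copyright (c) 2026 the pub-hodgecm-mathlib formalisation cell (harness21).  Prover seat hodgecm-mathlib-K2E3-p06 (g3), Track B «K2-LIT» ∕ h413, road J ∕ R3 (d)
brick (d-w-0) «exact Euler–Poincaré indices at a ramified place», FILE A (generic orbit–stabiliser on a graph).  2026-09-04.
-/
import Mathlib.Combinatorics.SimpleGraph.Basic
import Mathlib.GroupTheory.Index
import Mathlib.Data.Sym.Sym2
import HarnessLib

/-!
# Vertex and edge stabilisers of a dart-transitive group action on a graph: `[K_v : K_v ⊓ K_e] = deg v`, `[K_e : K_v ⊓ K_e] = 2`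
# (Serre, *Trees* (1980), Ch. I §3.1, Ch. II §1.1–§1.3; Kottwitz 1988 §2)

Topic `Combinatorics/SimpleGraph`; namespace `Literature.Combinatorics.SimpleGraph`.  THEOREMS ONLY (no definition, no instance visible to importers, no notation,
no named fact, no `sorry`); count-neutral helper, kernel lane `--supports stmt-HodgeConjecture-24833 --as helper`.  Cell `pub/hodgecm-mathlib`, crux H413
(`stmt-HodgeConjecture-24833`), Track B «K2-LIT», unit U3b, road J letter ‹J3› `sig_K2E3CompatibleMeasureEPIdentityRankOne`, R3 place class (d-w) «wildly ramified»:
brick (d-w-0) (dealer K2E3-plan (g2) 2026-09-04T01:34:25Z (D16)) — THE GENERIC HALF.  FILE B (`SLTwoTreeValency`) counts the star of the tree of `SL₂`; FILE C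
(`Theorems/K2E3RamifiedPlaceEPIndices`) reads both at the levels `(K♯_η, K, K♯_η ⊓ K)` of `U(Φ₂)(L⁺_v)` through ★ `rhoVertexActPlace` and the (W2) stabiliser heads.
HONEST LABEL: HC_CM is proved only modulo the 7 printed citations (2 remaining named inputs: hLiu418 = stmt-HodgeConjecture-24832, h413 = stmt-HodgeConjecture-24833)
until rung 0 closes; pure group-action bookkeeping, nothing printed is asserted.

## The mathematics

A group `G` acts on the vertices of a simple graph `X` by graph maps (`act : G → W → W`, `act 1 = id`, `act (gh) = act g ∘ act h`, `act g` preserves adjacency —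
the hypothesis shape of ★ `epEllipticRelation_vertexEdgeLevels_of_vertexAction_local` ∕ ★ `rankOneEulerPoincareNonsplit_of_treeActions`), with a base dart
`x₀ ~ x₁` and DART-TRANSITIVITY `hD : ∀ a ~ b, ∃ g, g·x₀ = a ∧ g·x₁ = b` (★ `exists_rhoVertexActPlace_eq_of_adj`).  Two subgroups are given by membership predicates
(token shape of the (W2) heads ★ `forall_coe_mem_glInt_iff_rhoVertexActPlace_root_eq`, ★ `forall_coe_mem_map_conj_glDiagonal_iff_sym2_rhoVertexActPlace_eq`):
`K_v = {g : g·x₀ = x₀}` (vertex stabiliser) and `K_e = {g : s(g·x₀, g·x₁) = s(x₀, x₁)}` (set-wise stabiliser of the base edge).  Then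
* `relIndex_inf_vertexStab_eq_ncard_neighborSet` — **`[K_v : K_v ⊓ K_e] = #(X.neighborSet x₀)`**: `K_v ⊓ K_e` is the stabiliser of `x₁` in `K_v`, and the `K_v`-orbit
  of `x₁` is the star of `x₀` (`⊆` by adjacency preservation, `⊇` by `hD` at the darts `(x₀, b)`) — orbit–stabiliser (Mathlib `MulAction.index_stabilizer`);
* `relIndex_inf_edgeStab_eq_two` — **`[K_e : K_v ⊓ K_e] = 2`**: the `K_e`-orbit of `x₀` is `{x₀, x₁}` (an element of `K_e` fixes or swaps the ends; `hD` at the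
  reversed dart `(x₁, x₀)` supplies an inversion), and `x₀ ≠ x₁`.
For a vertex- and dart-transitive action on a `(q+1)`-regular tree with inversions (`U(1,1)` at a ramified place on the tree of `SL₂`) these are Kottwitz's
Euler–Poincaré indices `q + 1` and `2` [Kottwitz1988, §2]; [Serre1980Trees, I §3.1 «G acts with inversion», II §1.1–1.3].

## References
* [Serre1980Trees] J.-P. Serre, *Trees* (1980), Ch. I §3.1 (actions with and without inversion), Ch. II §1.1–§1.3 (stabilisers of vertices and edges, stars).
* [Kottwitz1988] R. E. Kottwitz, *Tamagawa numbers*, Ann. of Math. 127 (1988), 629–646, §2 (the levels `K_σ` of the Euler–Poincaré function).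
-/

set_option autoImplicit false

namespace Literature.Combinatorics.SimpleGraph

section DartTransitive

variable {G : Type*} [Group G] {W : Type*} (X : _root_.SimpleGraph W) (act : G → W → W)
  (act_one : ∀ x, act 1 x = x) (act_mul : ∀ g h x, act (g * h) x = act g (act h x))
  (act_adj : ∀ g x y, X.Adj x y → X.Adj (act g x) (act g y))
  {x₀ x₁ : W} (h01 : X.Adj x₀ x₁)
  (hD : ∀ a b, X.Adj a b → ∃ g, act g x₀ = a ∧ act g x₁ = b)
  (Kv Ke : Subgroup G) (hKv : ∀ u, u ∈ Kv ↔ act u x₀ = x₀) (hKe : ∀ u, u ∈ Ke ↔ s(act u x₀, act u x₁) = s(x₀, x₁))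

include act_one act_mul act_adj h01 hD hKv hKe in
/-- **`[K_v : K_v ⊓ K_e] = #star(x₀)`** for a dart-transitive action by graph maps: the `K_v`-orbit of `x₁` is the neighbour set of `x₀` and its stabiliser in
`K_v` is `K_v ⊓ K_e`. [cite: Serre1980Trees, Ch. II §1.1–§1.3] [cite: Kottwitz1988, §2] -/
theorem relIndex_inf_vertexStab_eq_ncard_neighborSet : (Kv ⊓ Ke).relIndex Kv = (X.neighborSet x₀).ncard := by
  letI : SMul G W := ⟨act⟩
  letI : SemigroupAction G W := ⟨act_mul⟩
  letI : MulAction G W := ⟨act_one⟩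
  -- the stabiliser of `x₁` in `K_v` is `K_v ⊓ K_e`
  have hstab : (Kv ⊓ Ke).subgroupOf Kv = MulAction.stabilizer Kv x₁ := by
    ext k
    simp only [Subgroup.mem_subgroupOf, Subgroup.mem_inf, MulAction.mem_stabilizer_iff]
    change ((k : G) ∈ Kv ∧ (k : G) ∈ Ke) ↔ act (k : G) x₁ = x₁
    rw [hKe, (hKv k).1 k.2, Sym2.congr_right]
    exact ⟨fun h => h.2, fun h => ⟨k.2, h⟩⟩
  -- the `K_v`-orbit of `x₁` is the star of `x₀`
  have horb : MulAction.orbit Kv x₁ = X.neighborSet x₀ := by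
    ext b
    rw [MulAction.mem_orbit_iff, _root_.SimpleGraph.mem_neighborSet]
    constructor
    · rintro ⟨k, rfl⟩
      change X.Adj x₀ (act (k : G) x₁)
      have h := act_adj (k : G) x₀ x₁ h01
      rwa [(hKv k).1 k.2] at h
    · intro hb
      obtain ⟨g, hg0, hg1⟩ := hD x₀ b hb
      exact ⟨⟨g, (hKv g).2 hg0⟩, hg1⟩
  rw [Subgroup.relIndex, hstab, MulAction.index_stabilizer, horb]

include act_one act_mul hD hKv hKe h01 in
/-- **`[K_e : K_v ⊓ K_e] = 2`** for a dart-transitive action: the `K_e`-orbit of `x₀` is `{x₀, x₁}` (ends are fixed or swapped; `hD` at the reversed dart gives an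
inversion) and `x₀ ≠ x₁`. [cite: Serre1980Trees, Ch. I §3.1; Ch. II §1.1–§1.3] [cite: Kottwitz1988, §2] -/
theorem relIndex_inf_edgeStab_eq_two : (Kv ⊓ Ke).relIndex Ke = 2 := by
  letI : SMul G W := ⟨act⟩
  letI : SemigroupAction G W := ⟨act_mul⟩
  letI : MulAction G W := ⟨act_one⟩
  -- the stabiliser of `x₀` in `K_e` is `K_v ⊓ K_e`
  have hstab : (Kv ⊓ Ke).subgroupOf Ke = MulAction.stabilizer Ke x₀ := by
    ext k
    simp only [Subgroup.mem_subgroupOf, Subgroup.mem_inf, MulAction.mem_stabilizer_iff]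
    change ((k : G) ∈ Kv ∧ (k : G) ∈ Ke) ↔ act (k : G) x₀ = x₀
    rw [hKv]
    exact ⟨fun h => h.1, fun h => ⟨h, k.2⟩⟩
  -- the `K_e`-orbit of `x₀` is `{x₀, x₁}`
  have horb : MulAction.orbit Ke x₀ = {x₀, x₁} := by
    ext b
    rw [MulAction.mem_orbit_iff, Set.mem_insert_iff, Set.mem_singleton_iff]
    constructor
    · rintro ⟨k, rfl⟩
      change act (k : G) x₀ = x₀ ∨ act (k : G) x₀ = x₁
      have hk := (hKe k).1 k.2
      rcases Sym2.eq_iff.1 hk with ⟨h0, -⟩ | ⟨h0, -⟩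
      · exact Or.inl h0
      · exact Or.inr h0
    · intro hb
      rcases hb with hb | hb
      · rw [hb]
        exact ⟨1, one_smul _ _⟩
      · rw [hb]
        obtain ⟨g, hg0, hg1⟩ := hD x₁ x₀ h01.symm
        have hg : g ∈ Ke := by
          rw [hKe, hg0, hg1, Sym2.eq_swap]
        exact ⟨⟨g, hg⟩, hg0⟩
  rw [Subgroup.relIndex, hstab, MulAction.index_stabilizer, horb, Set.ncard_pair h01.ne]

include act_one act_mul act_adj hD hKv hKe h01 in
/-- Both indices at once: `[K_v : K_v ⊓ K_e] = #star(x₀)` and `[K_e : K_v ⊓ K_e] = 2` (for the `(q+1)`-regular tree of `SL₂` and `U(1,1)` at a ramified place: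
Kottwitz's `q + 1` and `2`). [cite: Kottwitz1988, §2] [cite: Serre1980Trees, Ch. II §1.1–§1.3] -/
theorem relIndex_inf_vertexStab_and_edgeStab :
    (Kv ⊓ Ke).relIndex Kv = (X.neighborSet x₀).ncard ∧ (Kv ⊓ Ke).relIndex Ke = 2 :=
  ⟨relIndex_inf_vertexStab_eq_ncard_neighborSet X act act_one act_mul act_adj h01 hD Kv Ke hKv hKe,
    relIndex_inf_edgeStab_eq_two X act act_one act_mul h01 hD Kv Ke hKv hKe⟩

end DartTransitive

/-! ## §2 Star-transitivity at the base vertex suffices for the vertex index -/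

section StarTransitive

variable {G : Type*} [Group G] {W : Type*} (X : _root_.SimpleGraph W) (act : G → W → W)
  (act_one : ∀ x, act 1 x = x) (act_mul : ∀ g h x, act (g * h) x = act g (act h x))
  (act_adj : ∀ g x y, X.Adj x y → X.Adj (act g x) (act g y))
  {x₀ x₁ : W} (h01 : X.Adj x₀ x₁)
  (hstar : ∀ b, X.Adj x₀ b → ∃ g, act g x₀ = x₀ ∧ act g x₁ = b)
  (Kv Ke : Subgroup G) (hKv : ∀ u, u ∈ Kv ↔ act u x₀ = x₀) (hKe : ∀ u, u ∈ Ke ↔ s(act u x₀, act u x₁) = s(x₀, x₁))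

include act_one act_mul act_adj h01 hstar hKv hKe in
/-- **`[K_v : K_v ⊓ K_e] = #star(x₀)` under STAR-TRANSITIVITY AT `x₀` ONLY** (`∀ b ~ x₀, ∃ g, g·x₀ = x₀ ∧ g·x₁ = b`) — the form used for a group that FIXES `x₀`
(e.g. `GL₂(𝒪)` on the tree of `SL₂`, `K_v = ⊤`, `K_v ⊓ K_e` = the Iwahori subgroup, star = the `q + 1` neighbours of the root).
[cite: Serre1980Trees, Ch. II §1.1–§1.3] [cite: Kottwitz1988, §2] -/
theorem relIndex_inf_vertexStab_eq_ncard_neighborSet_of_star : (Kv ⊓ Ke).relIndex Kv = (X.neighborSet x₀).ncard := by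
  letI : SMul G W := ⟨act⟩
  letI : SemigroupAction G W := ⟨act_mul⟩
  letI : MulAction G W := ⟨act_one⟩
  have hstab : (Kv ⊓ Ke).subgroupOf Kv = MulAction.stabilizer Kv x₁ := by
    ext k
    simp only [Subgroup.mem_subgroupOf, Subgroup.mem_inf, MulAction.mem_stabilizer_iff]
    change ((k : G) ∈ Kv ∧ (k : G) ∈ Ke) ↔ act (k : G) x₁ = x₁
    rw [hKe, (hKv k).1 k.2, Sym2.congr_right]
    exact ⟨fun h => h.2, fun h => ⟨k.2, h⟩⟩
  have horb : MulAction.orbit Kv x₁ = X.neighborSet x₀ := by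
    ext b
    rw [MulAction.mem_orbit_iff, _root_.SimpleGraph.mem_neighborSet]
    constructor
    · rintro ⟨k, rfl⟩
      change X.Adj x₀ (act (k : G) x₁)
      have h := act_adj (k : G) x₀ x₁ h01
      rwa [(hKv k).1 k.2] at h
    · intro hb
      obtain ⟨g, hg0, hg1⟩ := hstar b hb
      exact ⟨⟨g, (hKv g).2 hg0⟩, hg1⟩
  rw [Subgroup.relIndex, hstab, MulAction.index_stabilizer, horb]

include act_one act_mul act_adj h01 hstar hKe in
/-- **`[G : K_e] = #star(x₀)` when the whole group fixes `x₀`** (`K_v = ⊤`): the index of the stabiliser of the base edge equals the size of the star.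
[cite: Serre1980Trees, Ch. II §1.1] -/
theorem index_edgeStab_eq_ncard_neighborSet_of_forall_eq (hfix : ∀ g : G, act g x₀ = x₀) : Ke.index = (X.neighborSet x₀).ncard := by
  have h := relIndex_inf_vertexStab_eq_ncard_neighborSet_of_star X act act_one act_mul act_adj h01 hstar ⊤ Ke
    (fun u => ⟨fun _ => hfix u, fun _ => Subgroup.mem_top u⟩) hKe
  rwa [top_inf_eq, Subgroup.relIndex_top_right] at h

end StarTransitive

end Literature.Combinatorics.SimpleGraph
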